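import Summits.SmoothPoincare4.SmoothPoincare4.Theses.SymplecticOrigami
import Summits.SmoothPoincare4.SmoothPoincare4.Theses.SymplecticCap
import Summits.SmoothPoincare4.SmoothPoincare4.Theorems.SymplecticOrigamiGromovRecognitionRelEndStubWedgeDisjoint
import Summits.SmoothPoincare4.SmoothPoincare4.Theorems.SymplecticOrigamiGromovRecognitionRelEndStubPositiveHolonomyAux4
import Literature.Geometry.Symplectic.AlmostComplexStructure
import Literature.Geometry.Symplectic.GromovR4RelEnd

/-!
# Stub `stub_positiveHolonomy` of line `cross-cap-laurent` — positivity of the holonomy is automatic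
(crux `GromovRecognitionRelEnd`, item stmt-SmoothPoincare4-11009)

For the two `C^∞` retractions `λ_V : X → H∞`, `λ_H : X → V∞` of the wedge cap produced by the core of
the bi-foliation (kernels `J`-invariant and transverse, identity on the respective sphere), the
ORIENTATION clause of the apex is automatic: whenever `dλ_V v ≠ 0`,
`dλ_V (J v) = α dλ_V v + β J (dλ_V v)` with `β > 0`, and symmetrically for `λ_H`.

Proof (auxiliary files `…StubPositiveHolonomyAux1–4`): near every point `λ_V = η ∘ ℓ` in a cap
chart `η ∈ {ηH, ηC}` of `H∞` with `ℓ` valued in the axis plane `ℂ × 0` (flat charts, Aux2 — the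
corner case uses the gluing `ηC (u, 0) = ηH (1/u, 0)` beyond a compact piece of the axis and
`stub_wedgeDisjoint`); the clause at `(y, v)` is equivalent to positivity of the holonomy form
`dx₀∧dx₁ (dℓ v, dℓ (J v))`, whose sign depends neither on `v` (Aux1, Aux3) nor — locally — on `y`
(continuity of `dℓ` and `J` in charts, Aux4); `dλ_V ≠ 0` everywhere by transversality with the
`2`-dimensional kernels of `dλ_H`; `X` is connected and at the axis point `ηH 0` the clause holds with
`β = 1` (differentiate `λ_V ∘ ηH = ηH` along the axis).  The `V∞` half is the same statement after
the coordinate swap `(z₁, z₂) ↦ (z₂, z₁)` of `ℝ⁴`, which turns `ηV`, `ηC` into charts of the shape of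
`ηH`, `ηC`.
-/

noncomputable section

-- the prescribed namespace `Summit.<P>.<Sub>.…` duplicates `SmoothPoincare4` (P = Sub)
set_option linter.dupNamespace false

open scoped Manifold ContDiff Topology
open Set TopologicalSpace Literature.Geometry.Kaehler Literature.Geometry.Symplectic

namespace Summit.SmoothPoincare4.SmoothPoincare4.Theorems.GromovRecognitionRelEnd.CrossCapLaurent

/-- Model space `ℝ⁴ = ℂ²` (coordinates `0,1` = `z₁`, `2,3` = `z₂`). -/
local notation "E4" => EuclideanSpace ℝ (Fin 4)

/-- **Stub 4b′ — positivity of the holonomy is automatic (M/L; soft, split off the core by lead c1).**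
For two `C^∞` retractions `lamV`, `lamH` of the cap onto `H∞`, `V∞` with `JX`-invariant kernels meeting in
`0` (output of `stub_biFoliationCore`), the complex structure `Ĵ_y` induced on `im (d lamV)_y = T_{lamV y} H∞`
by `Ĵ (d lamV v) := d lamV (JX v)` is oriented like `JX|TH∞`: `d lamV (JX v) = α d lamV v + β JX (d lamV v)`
with `β > 0` whenever `d lamV v ≠ 0`; same for `lamH`.  Proof plan: (1) ranks: `ker (d lamV)_y` is
`JX`-invariant hence even-dimensional, `ker d lamV ∩ ker d lamH = 0` and both images lie in 2-planes
(`lamV` maps into `H∞`: near `y` it reads `ηH ∘ (ℓ, 0, 0)` in the affine case, `ηC ∘ (ℓ, 0)`-type near the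
corner — `H∞ ∩ ηC D_C = ηC (ℂ × 0)` by the gluing clause `ηC (u, 0) = ηH (1/u, 0)`), so both kernels are
2-planes and `im (d lamV)_y` is the whole tangent plane of `H∞` at `lamV y`; hence `Ĵ_y` is a well-defined
complex structure on that plane and for `w = d lamV v ≠ 0` the pair `{w, JX w}` is a basis of it, giving
unique `α, β` with `β ≠ 0` (`β = 0` would make `w` a real eigenvector of `Ĵ`); (2) the sign of `β` does not
depend on `v` (`T_yX ∖ ker` is connected, `β` continuous in `v`, never `0`) and is locally constant in `y`
(read `d lamV` in the cap charts of `H∞` — `ηH` on the affine part, `ηC` near the corner, where `JX|TH∞` is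
the constant `i` —; `y ↦ (d lamV)_y` is continuous: `ContMDiff.continuous_tangentMap`); (3) `X` is connected
and at an affine point `h = ηH (c, 0) ∈ H∞` one has `(d lamV)_h|_{T_h H∞} = id` (differentiate the retraction
identity `lamV ∘ ηH = ηH` along the axis), so `Ĵ_h = JX|T_hH∞`, `β = 1 > 0`; hence `β > 0` everywhere.
Symmetric for `lamH` with `ηV`/`ηC`.  Leans on: cap block (charts, holomorphy clauses), Mathlib tangent
bundle continuity, landed chart calculus; no curve theory. [folklore; cite: Wendl2018, proof of Thm 6.8 (orientation of the fibrations)] -/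
theorem stub_positiveHolonomy :
    ∀ (M : Type) [TopologicalSpace M] [T2Space M] [SecondCountableTopology M]
      [ChartedSpace E4 M] [IsManifold (𝓡 4) ∞ M] [ConnectedSpace M]
      (J : AlmostComplexStructure (𝓡 4) ∞ M) (K : Set M) (R R₁ : ℝ) (ψ : M → E4) (χ : E4 → M),
      ContMDiffOn (𝓡 4) 𝓘(ℝ, E4) ∞ ψ Kᶜ →
      ContMDiffOn 𝓘(ℝ, E4) (𝓡 4) ∞ χ (Metric.closedBall (0 : E4) R)ᶜ →
      Set.BijOn ψ Kᶜ (Metric.closedBall (0 : E4) R)ᶜ →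
      (∀ x, x ∈ Kᶜ → χ (ψ x) = x) →
      R < R₁ → 0 < R₁ →
      (∀ x, x ∈ Kᶜ → R₁ < ‖ψ x‖ → ∀ (v : TangentSpace (𝓡 4) x) (a : E4),
          a = mfderiv (𝓡 4) 𝓘(ℝ, E4) ψ x v →
          mfderiv (𝓡 4) 𝓘(ℝ, E4) ψ x (J x v) = WithLp.toLp 2 ![-(a 1), a 0, -(a 3), a 2]) →
      ∀ (X : Type) [TopologicalSpace X] [T2Space X] [SecondCountableTopology X] [CompactSpace X]
        [ConnectedSpace X] [ChartedSpace E4 X] [IsManifold (𝓡 4) ∞ X]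
        (ωX : MForm (𝓡 4) X ℝ 2) (JX : AlmostComplexStructure (𝓡 4) ∞ X) (ι : M → X)
        (ηH ηV ηC : E4 → X),
        (IsSmoothForm ωX ∧ IsClosedForm ωX ∧ JX.IsTamedBy ωX) ∧
        (IsLocalDiffeomorph (𝓡 4) (𝓡 4) ∞ ι ∧ Function.Injective ι ∧
          ∀ (x : M) (v : TangentSpace (𝓡 4) x),
            JX (ι x) (mfderiv (𝓡 4) (𝓡 4) ι x v) = mfderiv (𝓡 4) (𝓡 4) ι x (J x v)) ∧
        (IsLocalDiffeomorphOn 𝓘(ℝ, E4) (𝓡 4) ∞ ηV {p : E4 | p 0 ^ 2 + p 1 ^ 2 < R₁⁻¹ ^ 2} ∧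
          Set.InjOn ηV {p : E4 | p 0 ^ 2 + p 1 ^ 2 < R₁⁻¹ ^ 2} ∧
          (∀ p : E4, p 0 ^ 2 + p 1 ^ 2 < R₁⁻¹ ^ 2 → (p 0 ≠ 0 ∨ p 1 ≠ 0) →
            ηV p = ι (χ (WithLp.toLp 2
              ![p 0 / (p 0 ^ 2 + p 1 ^ 2), -(p 1) / (p 0 ^ 2 + p 1 ^ 2), p 2, p 3]))) ∧
          (∀ p : E4, p 0 = 0 → p 1 = 0 → ηV p ∉ Set.range ι) ∧
          (∀ p : E4, p 0 ^ 2 + p 1 ^ 2 < R₁⁻¹ ^ 2 → ∀ q : E4,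
            JX (ηV p) (mfderiv 𝓘(ℝ, E4) (𝓡 4) ηV p q) =
              mfderiv 𝓘(ℝ, E4) (𝓡 4) ηV p (WithLp.toLp 2 ![-(q 1), q 0, -(q 3), q 2]))) ∧
        (IsLocalDiffeomorphOn 𝓘(ℝ, E4) (𝓡 4) ∞ ηH {p : E4 | p 2 ^ 2 + p 3 ^ 2 < R₁⁻¹ ^ 2} ∧
          Set.InjOn ηH {p : E4 | p 2 ^ 2 + p 3 ^ 2 < R₁⁻¹ ^ 2} ∧
          (∀ p : E4, p 2 ^ 2 + p 3 ^ 2 < R₁⁻¹ ^ 2 → (p 2 ≠ 0 ∨ p 3 ≠ 0) →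
            ηH p = ι (χ (WithLp.toLp 2
              ![p 0, p 1, p 2 / (p 2 ^ 2 + p 3 ^ 2), -(p 3) / (p 2 ^ 2 + p 3 ^ 2)]))) ∧
          (∀ p : E4, p 2 = 0 → p 3 = 0 → ηH p ∉ Set.range ι) ∧
          (∀ p : E4, p 2 ^ 2 + p 3 ^ 2 < R₁⁻¹ ^ 2 → ∀ q : E4,
            JX (ηH p) (mfderiv 𝓘(ℝ, E4) (𝓡 4) ηH p q) =
              mfderiv 𝓘(ℝ, E4) (𝓡 4) ηH p (WithLp.toLp 2 ![-(q 1), q 0, -(q 3), q 2]))) ∧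
        (IsLocalDiffeomorphOn 𝓘(ℝ, E4) (𝓡 4) ∞ ηC
            {p : E4 | p 0 ^ 2 + p 1 ^ 2 < R₁⁻¹ ^ 2 ∧ p 2 ^ 2 + p 3 ^ 2 < R₁⁻¹ ^ 2} ∧
          Set.InjOn ηC {p : E4 | p 0 ^ 2 + p 1 ^ 2 < R₁⁻¹ ^ 2 ∧ p 2 ^ 2 + p 3 ^ 2 < R₁⁻¹ ^ 2} ∧
          (∀ p : E4, p 0 ^ 2 + p 1 ^ 2 < R₁⁻¹ ^ 2 → p 2 ^ 2 + p 3 ^ 2 < R₁⁻¹ ^ 2 →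
            (p 2 ≠ 0 ∨ p 3 ≠ 0) →
            ηC p = ηV (WithLp.toLp 2
              ![p 0, p 1, p 2 / (p 2 ^ 2 + p 3 ^ 2), -(p 3) / (p 2 ^ 2 + p 3 ^ 2)])) ∧
          (∀ p : E4, p 0 ^ 2 + p 1 ^ 2 < R₁⁻¹ ^ 2 → p 2 ^ 2 + p 3 ^ 2 < R₁⁻¹ ^ 2 →
            (p 0 ≠ 0 ∨ p 1 ≠ 0) →
            ηC p = ηH (WithLp.toLp 2
              ![p 0 / (p 0 ^ 2 + p 1 ^ 2), -(p 1) / (p 0 ^ 2 + p 1 ^ 2), p 2, p 3])) ∧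
          ηC 0 ∉ Set.range ι ∧
          (∀ p : E4, p 0 ^ 2 + p 1 ^ 2 < R₁⁻¹ ^ 2 → p 2 ^ 2 + p 3 ^ 2 < R₁⁻¹ ^ 2 → ∀ q : E4,
            JX (ηC p) (mfderiv 𝓘(ℝ, E4) (𝓡 4) ηC p q) =
              mfderiv 𝓘(ℝ, E4) (𝓡 4) ηC p (WithLp.toLp 2 ![-(q 1), q 0, -(q 3), q 2]))) ∧
        (∀ y : X, y ∈ Set.range ι ∨ (∃ p : E4, p 0 ^ 2 + p 1 ^ 2 < R₁⁻¹ ^ 2 ∧ ηV p = y) ∨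
          (∃ p : E4, p 2 ^ 2 + p 3 ^ 2 < R₁⁻¹ ^ 2 ∧ ηH p = y) ∨
          (∃ p : E4, (p 0 ^ 2 + p 1 ^ 2 < R₁⁻¹ ^ 2 ∧ p 2 ^ 2 + p 3 ^ 2 < R₁⁻¹ ^ 2) ∧ ηC p = y)) →
        ∀ (lamV lamH : X → X),
        ContMDiff (𝓡 4) (𝓡 4) ∞ lamV →
        ContMDiff (𝓡 4) (𝓡 4) ∞ lamH →
        (∀ y : X, (∃ p : E4, p 2 = 0 ∧ p 3 = 0 ∧ ηH p = lamV y) ∨ lamV y = ηC 0) →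
        (∀ p : E4, p 2 = 0 → p 3 = 0 → lamV (ηH p) = ηH p) →
        lamV (ηC 0) = ηC 0 →
        (∀ y : X, (∃ q : E4, q 0 = 0 ∧ q 1 = 0 ∧ ηV q = lamH y) ∨ lamH y = ηC 0) →
        (∀ q : E4, q 0 = 0 → q 1 = 0 → lamH (ηV q) = ηV q) →
        lamH (ηC 0) = ηC 0 →
        (∀ y : X, lamV y = ηC 0 ↔ ((∃ q : E4, q 0 = 0 ∧ q 1 = 0 ∧ ηV q = y) ∨ y = ηC 0)) →
        (∀ y : X, lamH y = ηC 0 ↔ ((∃ p : E4, p 2 = 0 ∧ p 3 = 0 ∧ ηH p = y) ∨ y = ηC 0)) →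
        (∀ (y : X) (v : TangentSpace (𝓡 4) y), mfderiv (𝓡 4) (𝓡 4) lamV y v = 0 →
          mfderiv (𝓡 4) (𝓡 4) lamV y (JX y v) = 0) →
        (∀ (y : X) (v : TangentSpace (𝓡 4) y), mfderiv (𝓡 4) (𝓡 4) lamH y v = 0 →
          mfderiv (𝓡 4) (𝓡 4) lamH y (JX y v) = 0) →
        (∀ (y : X) (v : TangentSpace (𝓡 4) y), mfderiv (𝓡 4) (𝓡 4) lamV y v = 0 →
          mfderiv (𝓡 4) (𝓡 4) lamH y v = 0 → v = 0) →
        (∀ (y : X) (v : TangentSpace (𝓡 4) y), mfderiv (𝓡 4) (𝓡 4) lamV y v ≠ 0 →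
          ∃ α β : ℝ, 0 < β ∧ mfderiv (𝓡 4) (𝓡 4) lamV y (JX y v) =
            α • mfderiv (𝓡 4) (𝓡 4) lamV y v + β • JX (lamV y) (mfderiv (𝓡 4) (𝓡 4) lamV y v)) ∧
        (∀ (y : X) (v : TangentSpace (𝓡 4) y), mfderiv (𝓡 4) (𝓡 4) lamH y v ≠ 0 →
          ∃ α β : ℝ, 0 < β ∧ mfderiv (𝓡 4) (𝓡 4) lamH y (JX y v) =
            α • mfderiv (𝓡 4) (𝓡 4) lamH y v + β • JX (lamH y) (mfderiv (𝓡 4) (𝓡 4) lamH y v)) := by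
  intro M _ _ _ _ _ _ J K R R₁ ψ χ h6 h7 h8 h9 hR hR₁ h10 X _ _ _ _ _ _ _ ωX JX ι ηH ηV ηC hW lamV lamH
    hsV hsH hinH hrH _ hinV hrV _ _ _ hJV hJH htr
  -- the wedge is a wedge: the affine axes miss the corner (`stub_wedgeDisjoint`)
  obtain ⟨-, hHC, hVC⟩ :=
    stub_wedgeDisjoint M J K R R₁ ψ χ h6 h7 h8 h9 hR hR₁ h10 X ωX JX ι ηH ηV ηC hW
  obtain ⟨-, -, ⟨hVloc, hVinj, -, -, hVhol⟩, ⟨hHloc, hHinj, -, -, hHhol⟩,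
    ⟨hCloc, hCinj, hCV, hCH, -, hChol⟩, -⟩ := hW
  set DV : Set E4 := {p : E4 | p 0 ^ 2 + p 1 ^ 2 < R₁⁻¹ ^ 2}
  set DH : Set E4 := {p : E4 | p 2 ^ 2 + p 3 ^ 2 < R₁⁻¹ ^ 2}
  set DC : Set E4 := {p : E4 | p 0 ^ 2 + p 1 ^ 2 < R₁⁻¹ ^ 2 ∧ p 2 ^ 2 + p 3 ^ 2 < R₁⁻¹ ^ 2}
  have hR₁' : (0 : ℝ) < R₁⁻¹ ^ 2 := by positivity
  have hDVo : IsOpen DV := isOpen_lt CapModel.continuous_r1 continuous_const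
  have hDHo : IsOpen DH := isOpen_lt CapModel.continuous_r2 continuous_const
  have hDCo : IsOpen DC :=
    (isOpen_lt CapModel.continuous_r1 continuous_const).and
      (isOpen_lt CapModel.continuous_r2 continuous_const)
  -- holomorphy of the three cap charts, `i ⊕ i = I4`
  have hVhol' : ∀ p ∈ DV, ∀ q : E4, JX (ηV p) (mfderiv 𝓘(ℝ, E4) (𝓡 4) ηV p q) =
      mfderiv 𝓘(ℝ, E4) (𝓡 4) ηV p (CapModel.I4 q) := fun p hp q => hVhol p hp q
  have hHhol' : ∀ p ∈ DH, ∀ q : E4, JX (ηH p) (mfderiv 𝓘(ℝ, E4) (𝓡 4) ηH p q) =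
      mfderiv 𝓘(ℝ, E4) (𝓡 4) ηH p (CapModel.I4 q) := fun p hp q => hHhol p hp q
  have hChol' : ∀ p ∈ DC, ∀ q : E4, JX (ηC p) (mfderiv 𝓘(ℝ, E4) (𝓡 4) ηC p q) =
      mfderiv 𝓘(ℝ, E4) (𝓡 4) ηC p (CapModel.I4 q) := fun p hp q => hChol p hp.1 hp.2 q
  -- flat charts of `λ_V` (charts `ηH`, `ηC` of `H∞`)
  have haxH : ∀ p : E4, p 2 = 0 → p 3 = 0 → p ∈ DH := by
    intro p h2 h3
    show p 2 ^ 2 + p 3 ^ 2 < R₁⁻¹ ^ 2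
    rw [h2, h3]; simpa using hR₁'
  have h0C : (0 : E4) ∈ DC := ⟨by simpa using hR₁', by simpa using hR₁'⟩
  have h0H : (0 : E4) ∈ DH := haxH 0 (by simp) (by simp)
  have hglueH : ∀ p : E4, p 2 = 0 → p 3 = 0 → R₁ ^ 2 < CapModel.r1 p →
      ∃ p' ∈ DC, p' 2 = 0 ∧ p' 3 = 0 ∧ ηC p' = ηH p := by
    intro p h2 h3 hp
    have hr0 : CapModel.r1 p ≠ 0 := CapModel.r1_ne_zero_of_sq_lt hp
    have h1 : CapModel.r1 (CapModel.inv1 p) < R₁⁻¹ ^ 2 := CapModel.r1_inv1_lt hR₁ hp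
    have h2' : CapModel.r2 (CapModel.inv1 p) < R₁⁻¹ ^ 2 := by
      rw [CapModel.r2_inv1, CapModel.r2_def, h2, h3]; simpa using hR₁'
    have hne : CapModel.inv1 p 0 ≠ 0 ∨ CapModel.inv1 p 1 ≠ 0 :=
      (CapModel.r1_ne_zero_iff _).1 (by rw [CapModel.r1_inv1]; exact inv_ne_zero hr0)
    refine ⟨CapModel.inv1 p, ⟨h1, h2'⟩, by simp [h2], by simp [h3], ?_⟩
    have hg := hCH (CapModel.inv1 p) h1 h2' hne
    change ηC (CapModel.inv1 p) = ηH (CapModel.inv1 (CapModel.inv1 p)) at hg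
    rw [CapModel.inv1_inv1 hr0] at hg
    exact hg
  have HFV := fun y₀ => PosHolonomy.exists_flatChart hsV.continuous hDHo hHloc hHinj hHhol' hDCo
    hCloc hCinj hChol' hinH haxH h0C hHC hglueH y₀
  -- flat charts of `λ_H`: the charts `ηV ∘ S`, `ηC ∘ S` of `V∞`, `S` the coordinate swap
  obtain ⟨S, hS⟩ := PosHolonomy.exists_swap
  have hSS := PosHolonomy.swap_swap hS
  have hS0 : S 0 = 0 := map_zero S
  have hAloc := PosHolonomy.isLocalDiffeomorphOn_comp_equiv S hVloc
  have hAinj := PosHolonomy.injOn_comp_equiv S hVinj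
  have hAhol := PosHolonomy.hol_comp_equiv S hVloc hVhol' (PosHolonomy.swap_I4 hS)
  have hKloc := PosHolonomy.isLocalDiffeomorphOn_comp_equiv S hCloc
  have hKinj := PosHolonomy.injOn_comp_equiv S hCinj
  have hKhol := PosHolonomy.hol_comp_equiv S hCloc hChol' (PosHolonomy.swap_I4 hS)
  have hinV' : ∀ y, (∃ p : E4, p 2 = 0 ∧ p 3 = 0 ∧ (ηV ∘ S) p = lamH y) ∨ lamH y = (ηC ∘ S) 0 := by
    intro y
    rcases hinV y with ⟨q, hq0, hq1, he⟩ | he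
    · refine Or.inl ⟨S q, (hS q).2.2.1.trans hq0, (hS q).2.2.2.trans hq1, ?_⟩
      show ηV (S (S q)) = lamH y
      rw [hSS]; exact he
    · right
      show lamH y = ηC (S 0)
      rw [hS0]; exact he
  have haxV : ∀ p : E4, p 2 = 0 → p 3 = 0 → p ∈ S ⁻¹' DV := by
    intro p h2 h3
    show (S p) 0 ^ 2 + (S p) 1 ^ 2 < R₁⁻¹ ^ 2
    rw [(hS p).1, (hS p).2.1, h2, h3]; simpa using hR₁'
  have h0C' : (0 : E4) ∈ S ⁻¹' DC := by
    show S 0 ∈ DC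
    rw [hS0]; exact h0C
  have h0V' : (0 : E4) ∈ S ⁻¹' DV := haxV 0 rfl rfl
  have hdisjV : ∀ p : E4, p 2 = 0 → p 3 = 0 → (ηV ∘ S) p ≠ (ηC ∘ S) 0 := by
    intro p h2 h3
    show ηV (S p) ≠ ηC (S 0)
    rw [hS0]
    exact hVC (S p) ((hS p).1.trans h2) ((hS p).2.1.trans h3)
  have hglueV : ∀ p : E4, p 2 = 0 → p 3 = 0 → R₁ ^ 2 < CapModel.r1 p →
      ∃ p' ∈ S ⁻¹' DC, p' 2 = 0 ∧ p' 3 = 0 ∧ (ηC ∘ S) p' = (ηV ∘ S) p := by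
    intro p h2 h3 hp
    have hr0 : CapModel.r1 p ≠ 0 := CapModel.r1_ne_zero_of_sq_lt hp
    have h1 : CapModel.r1 (CapModel.inv1 p) < R₁⁻¹ ^ 2 := CapModel.r1_inv1_lt hR₁ hp
    have h2' : CapModel.r2 (CapModel.inv1 p) = 0 := by
      rw [CapModel.r2_inv1, CapModel.r2_def, h2, h3]; ring
    have hm1 : CapModel.r1 (S (CapModel.inv1 p)) < R₁⁻¹ ^ 2 := by
      rw [PosHolonomy.r1_swap hS, h2']; exact hR₁'
    have hm2 : CapModel.r2 (S (CapModel.inv1 p)) < R₁⁻¹ ^ 2 := by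
      rw [PosHolonomy.r2_swap hS]; exact h1
    have hne : S (CapModel.inv1 p) 2 ≠ 0 ∨ S (CapModel.inv1 p) 3 ≠ 0 :=
      (CapModel.r2_ne_zero_iff _).1
        (by rw [PosHolonomy.r2_swap hS, CapModel.r1_inv1]; exact inv_ne_zero hr0)
    refine ⟨CapModel.inv1 p, ⟨hm1, hm2⟩, by simp [h2], by simp [h3], ?_⟩
    have hg := hCV (S (CapModel.inv1 p)) hm1 hm2 hne
    change ηC (S (CapModel.inv1 p)) = ηV (CapModel.inv2 (S (CapModel.inv1 p))) at hg
    show ηC (S (CapModel.inv1 p)) = ηV (S p)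
    rw [hg, ← PosHolonomy.swap_inv1 hS, CapModel.inv1_inv1 hr0]
  have HFH := fun y₀ => PosHolonomy.exists_flatChart hsH.continuous
    (PosHolonomy.isOpen_preimage_equiv S hDVo) hAloc hAinj hAhol
    (PosHolonomy.isOpen_preimage_equiv S hDCo) hKloc hKinj hKhol hinV' haxV h0C' hdisjV hglueV y₀
  -- the retraction identities along the two axes
  have hretH : ∀ q : E4, lamV (ηH (CapModel.P01 q)) = ηH (CapModel.P01 q) := fun q =>
    hrH (CapModel.P01 q) (by simp [CapModel.P01_apply]) (by simp [CapModel.P01_apply])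
  have hretV : ∀ q : E4, lamH ((ηV ∘ S) (CapModel.P01 q)) = (ηV ∘ S) (CapModel.P01 q) := fun q =>
    hrV (S (CapModel.P01 q)) ((hS _).1.trans (by simp [CapModel.P01_apply]))
      ((hS _).2.1.trans (by simp [CapModel.P01_apply]))
  -- the one-sided theorem, twice
  exact ⟨PosHolonomy.pos_holonomy_oneSided JX hsV hsH HFV HFH hJV htr hDHo hHloc hHinj hHhol' h0H
      hretH,
    PosHolonomy.pos_holonomy_oneSided JX hsH hsV HFH HFV hJH (fun y v h1 h2 => htr y v h2 h1)
      (PosHolonomy.isOpen_preimage_equiv S hDVo) hAloc hAinj hAhol h0V' hretV⟩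

/-- **Registered helper sub-goal `helper_positiveHolonomyCoeffUnique`** (companion of
`stub_positiveHolonomy`, whose registered signature exceeds the registry's length bound): the
coefficients of a vector on the pair `(w, J w)` are unique when `J² = -1` and `w ≠ 0` — the
uniqueness half of the orientation clause. [folklore] -/
theorem helper_positiveHolonomyCoeffUnique : ∀ (V : Type) [AddCommGroup V] [Module ℝ V]
    (J : V →ₗ[ℝ] V), (∀ v, J (J v) = -v) → ∀ (w : V), w ≠ 0 → ∀ α β α' β' : ℝ,
    α • w + β • J w = α' • w + β' • J w → α = α' ∧ β = β' :=
  fun _ _ _ J hJ _ hw _ _ _ _ h => PosHolonomy.coeff_unique J hJ hw h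

end Summit.SmoothPoincare4.SmoothPoincare4.Theorems.GromovRecognitionRelEnd.CrossCapLaurent

end
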